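import Summits.AnomalousDissipation.AnomalousDissipation.Theorems.KolmogorovFloorEnsembleCeiling.Negative.DodgerSum
import Summits.AnomalousDissipation.AnomalousDissipation.Theorems.KolmogorovFloorEnsembleCeiling.Negative.DodgerEndgame
import Summits.AnomalousDissipation.AnomalousDissipation.Theorems.TaylorCertificatesPacketLemma

/-!
# No Kolmogorov-class floor for a force with cheap truncated dodgers (negative side of
# `KolmogorovFloorEnsembleCeiling`, stmt-AnomalousDissipation-14183), part 3/3: the kill

Line lead `prover-line-stmt-AnomalousDissipation-14183-0` (2026-08-16). Kernel-checked kill form of the paper theorem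
`FloorWitnessForcesDodgerRoughness` (card `Cruxes/KolmogorovFloor/Ideas/truncated-euler-k41-hot.md`):

* `kFloor_false_of_cheapDodgers` — `PacketLemma → IsSmooth f → CheapDodgers f → 0 < ε₀ → 0 < ν₀ →
  (∀ ν ∈ (0,ν₀), KolmogorovFloorDatumAt f ε₀ C Θ ν) → False`. At the matched viscosity `ν = (C/N')^{4/3}` the
  certificate's multiplier has degree `N ≤ N'`; choose `δ` small (`exists_small_delta`) and the level large, run the
  sign-averaged floor (`DodgerSum.floor_sum_at_level`) inside the Leray ball (`DodgerEndgame.dodger_ball`) and close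
  with `DodgerEndgame.dodger_endgame` in the cube-root variables; the degenerate case `C ≤ 0` dies at rest.
* `not_pairWitness_of_cheapDodgers` — per force: the `∀ ν`-body of the pair is false for such an `f`;
* `pair_false_of_cheapDodgers` — the pincer form: `PacketLemma → (∀ f adm, CheapDodgers f) → ¬KolmogorovFloorEnsembleCeiling`;
* `kFloor_false_of_cheapDodgers'`, `not_pairWitness_of_cheapDodgers'`, `pair_false_of_cheapDodgers'` — the same with
  `PacketLemma` DISCHARGED by the tree's `Theorems.packetLemma_proof` (item stmt-14032, closed 2026-08-16): the only
  remaining hypothesis is the dodger one, `CheapDodgers f` (per force) resp. `∀ f adm, CheapDodgers f` (pincer form),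
  which is OPEN for every named force (least-enstrophy dodger census filed on the item as kit evidence).

Nothing here asserts a Theses statement unconditionally.
-/


noncomputable section

open MeasureTheory UnitAddTorus
open scoped InnerProductSpace ENNReal

namespace Summit.AnomalousDissipation.AnomalousDissipation.Theorems.KolmogorovFloorEnsembleCeiling.Negative

open Literature.Analysis.FunctionSpaces Literature.Analysis.FunctionSpaces.Torus Literature.Analysis.FluidPDE
open Summit.AnomalousDissipation.AnomalousDissipation.Theses.TaylorCertificates
open Summit.AnomalousDissipation.AnomalousDissipation.Theorems.TaylorCertificatePair.Negative

/-! ## The kill -/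

/-- Choice of the smallness parameter: for `P, S, F > 0`, `Q ≥ 0` there is `δ > 0` with `Pδ ≤ ε₀/2`,
`Q√δ ≤ ε₀/2` and `δS ≤ 4F`. -/
theorem exists_small_delta {ε₀ P Q S F : ℝ} (hε₀ : 0 < ε₀) (hP : 0 < P) (hQ : 0 ≤ Q) (hS : 0 < S) (hF : 0 < F) :
    ∃ δ : ℝ, 0 < δ ∧ P * δ ≤ ε₀ / 2 ∧ Q * Real.sqrt δ ≤ ε₀ / 2 ∧ δ * S ≤ 4 * F := by
  set δ₁ : ℝ := ε₀ / (2 * P + 2) with hδ₁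
  set δ₂ : ℝ := (ε₀ / (2 * Q + 2)) ^ 2 with hδ₂
  set δ₃ : ℝ := 4 * F / S with hδ₃
  have hden1 : 0 < 2 * P + 2 := by positivity
  have hden2 : 0 < 2 * Q + 2 := by positivity
  have hδ1pos : 0 < δ₁ := div_pos hε₀ hden1
  have hδ2pos : 0 < δ₂ := by rw [hδ₂]; exact pow_pos (div_pos hε₀ hden2) 2
  have hδ3pos : 0 < δ₃ := div_pos (by linarith) hS
  refine ⟨min (min δ₁ δ₂) δ₃, lt_min (lt_min hδ1pos hδ2pos) hδ3pos, ?_, ?_, ?_⟩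
  · have hle : min (min δ₁ δ₂) δ₃ ≤ δ₁ := le_trans (min_le_left _ _) (min_le_left _ _)
    have h1 : P * min (min δ₁ δ₂) δ₃ ≤ P * δ₁ := mul_le_mul_of_nonneg_left hle hP.le
    have h2 : P * δ₁ ≤ ε₀ / 2 := by
      rw [hδ₁, mul_div_assoc', div_le_div_iff₀ hden1 two_pos]
      nlinarith
    linarith
  · have hle : min (min δ₁ δ₂) δ₃ ≤ δ₂ := le_trans (min_le_left _ _) (min_le_right _ _)
    have h1 : Real.sqrt (min (min δ₁ δ₂) δ₃) ≤ ε₀ / (2 * Q + 2) := by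
      rw [Real.sqrt_le_left (div_pos hε₀ hden2).le, ← hδ₂]
      exact hle
    have h2 : Q * Real.sqrt (min (min δ₁ δ₂) δ₃) ≤ Q * (ε₀ / (2 * Q + 2)) := mul_le_mul_of_nonneg_left h1 hQ
    have h3 : Q * (ε₀ / (2 * Q + 2)) ≤ ε₀ / 2 := by
      rw [mul_div_assoc', div_le_div_iff₀ hden2 two_pos]
      nlinarith
    linarith
  · have hle : min (min δ₁ δ₂) δ₃ ≤ δ₃ := min_le_right _ _
    have h1 : min (min δ₁ δ₂) δ₃ * S ≤ δ₃ * S := mul_le_mul_of_nonneg_right hle hS.le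
    rw [hδ₃, div_mul_cancel₀ _ hS.ne'] at h1
    exact h1

/-- **No Kolmogorov-class floor for a force with cheap dodgers, `C > 0`.** The main case of
`kFloor_false_of_cheapDodgers`, with the packet lemma's constant `K₁` and body given explicitly. -/
theorem kFloor_false_of_cheapDodgers_posC {K₁ : ℕ}
    (hK₁ : ∀ D : ℕ, 1 ≤ D → ∀ W : UnitAddTorus (Fin 3) → EuclideanSpace ℝ (Fin 3), IsSmooth W → IsDivFree W →
      fourierTruncate D W = W → ∀ s : ℝ, (∀ (x : UnitAddTorus (Fin 3)) (η : EuclideanSpace ℝ (Fin 3)), ‖η‖ = 1 →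
        |⟪η, convect (fun _ => η) W x⟫_ℝ| ≤ s) →
      ∀ (x₀ : UnitAddTorus (Fin 3)) (ξ : EuclideanSpace ℝ (Fin 3)), ‖ξ‖ = 1 →
        ∃ w : UnitAddTorus (Fin 3) → EuclideanSpace ℝ (Fin 3), IsSmooth w ∧ IsDivFree w ∧ HasZeroMean w ∧
          fourierTruncate (2 * D) w = 0 ∧ fourierTruncate (K₁ * D) w = w ∧ ∫ x, ‖w x‖ ^ 2 = 1 ∧
            ∫ x, ⟪w x, convect w W x⟫_ℝ ≤ ⟪ξ, convect (fun _ => ξ) W x₀⟫_ℝ + s / 4)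
    {f : UnitAddTorus (Fin 3) → EuclideanSpace ℝ (Fin 3)} (hf : IsSmooth f) (hcheap : CheapDodgers f)
    {ε₀ C Θ ν₀ : ℝ} (hε₀ : 0 < ε₀) (hν₀ : 0 < ν₀) (hC : 0 < C) (hΘ : 0 ≤ Θ) (hF : 0 < ∫ x, ‖f x‖ ^ 2)
    (hfloor : ∀ ν : ℝ, 0 < ν → ν < ν₀ → KolmogorovFloorDatumAt f ε₀ C Θ ν) : False := by
  -- constants
  set B : ℝ := 1 + 2 * Θ with hBdef
  have hB : 1 ≤ B := by rw [hBdef]; linarith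
  set F : ℝ := ∫ x, ‖f x‖ ^ 2 with hFdef
  have hC43 : 0 < C ^ (4 / 3 : ℝ) := Real.rpow_pos_of_pos hC _
  have hC83 : 0 < C ^ (8 / 3 : ℝ) := Real.rpow_pos_of_pos hC _
  -- the smallness `δ`
  obtain ⟨δ, hδ, hsmall1, hsmall2, hsmall3⟩ := exists_small_delta hε₀
    (show 0 < (4 * B + 1) * C ^ (4 / 3 : ℝ) by positivity)
    (show 0 ≤ 16 * Real.pi ^ 2 * B * (K₁ : ℝ) ^ 2 * 51 * C ^ (8 / 3 : ℝ) by positivity) hC83 hF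
  -- the level threshold
  set R : ℝ := 1 + C + (C / ν₀ + 1) + (32 * Real.pi ^ 2 * B * (K₁ : ℝ) ^ 2 * C ^ 4 / ε₀ + 1) +
    ((102 * Real.sqrt δ + 2) * C ^ 4 / (8 * F) + 1) with hRdef
  obtain ⟨N₀, hN₀⟩ := exists_nat_gt R
  obtain ⟨n, hn₀, a, ha, hE0, hEa⟩ := hcheap δ hδ N₀
  have hR1 : 0 ≤ C / ν₀ + 1 := by positivity
  have hR2 : 0 ≤ 32 * Real.pi ^ 2 * B * (K₁ : ℝ) ^ 2 * C ^ 4 / ε₀ + 1 := by positivity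
  have hR3 : 0 ≤ (102 * Real.sqrt δ + 2) * C ^ 4 / (8 * F) + 1 := by positivity
  have hnR : R < n := lt_of_lt_of_le hN₀ (by exact_mod_cast hn₀)
  have hn1 : (1 : ℝ) ≤ n := by linarith
  have hnC : C ≤ n := by linarith
  have hnν : C / ν₀ < n := by linarith
  have hnA : 32 * Real.pi ^ 2 * B * (K₁ : ℝ) ^ 2 * C ^ 4 / ε₀ ≤ n := by linarith
  have hnB : (102 * Real.sqrt δ + 2) * C ^ 4 / (8 * F) ≤ n := by linarith
  have hnpos : (0 : ℝ) < n := by linarith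
  have hn1nat : 1 ≤ n := by exact_mod_cast hn1
  -- cube-root bookkeeping at the matched viscosity `ν = (C/n)^{4/3}`
  obtain ⟨hx, hy, hx1, hy1, hx3, hy3, hxy3, hνx, hνinv, hn43, hn83⟩ := cubeRoot_bookkeeping hC hn1 hnC
  obtain ⟨hxy4, hxy8, hxy12, hx12y6⟩ := cubeRoot_products hC hnpos
  set x : ℝ := (C / n) ^ (1 / 3 : ℝ) with hxdef
  set y : ℝ := (n : ℝ) ^ (1 / 3 : ℝ) with hydef
  set ν : ℝ := (C / n) ^ (4 / 3 : ℝ) with hνdef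
  have hν : 0 < ν := by rw [hνx]; positivity
  have hνν₀ : ν < ν₀ := by
    have h1 : x ^ 4 ≤ x ^ 3 := by
      have : x ^ 4 = x ^ 3 * x := by ring
      rw [this]
      exact mul_le_of_le_one_right (by positivity) hx1
    have h2 : C / n < ν₀ := by rwa [div_lt_iff₀ hnpos, ← div_lt_iff₀' hν₀]
    rw [hνx]
    linarith [hx3]
  -- the certificate at `ν`
  obtain ⟨N, Φ₁, θ₁, hN, hband, hΘ1, hθ1, hu⟩ := hfloor ν hν hνν₀
  have hNn : N ≤ n := by
    have h1 : (N : ℝ) ≤ n := by rw [hνinv] at hN; exact hN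
    exact_mod_cast h1
  -- amplitude and room in the Leray ball
  set Ea : ℝ := gradNormSq a with hEadef
  have hEa0 : 0 ≤ Ea := gradNormSq_nonneg a
  set τ : ℝ := 51 * ν * Real.sqrt Ea + ν ^ 2 with hτdef
  have hE0' : (∫ z, ‖a z‖ ^ 2) ≤ δ * y ^ 8 := by rw [← hn83]; exact hE0
  have hEa' : Ea ≤ δ * y ^ 4 := by rw [← hn43]; exact hEa
  have hδF : δ * (x * y) ^ 8 ≤ 4 * F := by rw [hxy8]; exact hsmall3
  have hnF : (102 * Real.sqrt δ + 2) * (x * y) ^ 12 ≤ 8 * F * y ^ 3 := by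
    rw [hxy12, hy3]
    have h := (div_le_iff₀ (by linarith : (0 : ℝ) < 8 * F)).1 hnB
    linarith
  have hroom : 2 * (∫ z, ‖a z‖ ^ 2) + 2 * τ ≤ 16 * (∫ z, ‖f z‖ ^ 2) / ν ^ 2 := by
    have h2 := dodger_ball hx hx1 hy1 hδ.le hF.le hE0' hEa' hδF hnF
    have e2 : 51 * x ^ 4 * Real.sqrt Ea + x ^ 8 = τ := by rw [hτdef, hνx]; ring
    rw [e2, ← hνx] at h2
    exact h2
  -- the sign-averaged floor at this level
  have hmain := floor_sum_at_level hn1nat hNn hf ha (hK₁ n hn1nat) hν hΘ1 hθ1 hτdef hband hu hroom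
  -- endgame in the cube-root variables
  have hmain' : 2 * ε₀ ≤ (4 * B + 1) * (x ^ 4 * Ea) +
      4 * B * x ^ 4 * (51 * x ^ 4 * Real.sqrt Ea + x ^ 8) * (4 * Real.pi ^ 2 * (K₁ : ℝ) ^ 2 * (y ^ 3) ^ 2) := by
    have e2 : τ = 51 * x ^ 4 * Real.sqrt Ea + x ^ 8 := by rw [hτdef, hνx]; ring
    have e3 : ((K₁ * n : ℕ) : ℝ) ^ 2 = (K₁ : ℝ) ^ 2 * (y ^ 3) ^ 2 := by
      rw [hy3]; push_cast; ring
    rw [hνx, e2, e3] at hmain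
    have e4 : (4 * (1 + 2 * Θ) + 1) = 4 * B + 1 := by rw [hBdef]
    have e5 : 4 * (1 + 2 * Θ) = 4 * B := by rw [hBdef]
    rw [e4, e5] at hmain
    linarith [hmain]
  have hδ1' : (4 * B + 1) * (x * y) ^ 4 * δ ≤ ε₀ / 2 := by rw [hxy4]; exact hsmall1
  have hδ2' : 16 * Real.pi ^ 2 * B * (K₁ : ℝ) ^ 2 * 51 * (x * y) ^ 8 * Real.sqrt δ ≤ ε₀ / 2 := by
    rw [hxy8]; exact hsmall2
  have hn' : 16 * Real.pi ^ 2 * B * (K₁ : ℝ) ^ 2 * (x ^ 12 * y ^ 6) ≤ ε₀ / 2 := by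
    rw [hx12y6]
    have hn2 : (n : ℝ) ≤ (n : ℝ) ^ 2 := le_self_pow₀ hn1 two_ne_zero
    have h1 : 32 * Real.pi ^ 2 * B * (K₁ : ℝ) ^ 2 * C ^ 4 ≤ ε₀ * (n : ℝ) ^ 2 := by
      have h := (div_le_iff₀ hε₀).1 hnA
      have h' := mul_le_mul_of_nonneg_left hn2 hε₀.le
      linarith [h, h']
    rw [mul_div_assoc', div_le_div_iff₀ (by positivity : (0 : ℝ) < (n : ℝ) ^ 2) two_pos]
    linarith [h1]
  exact dodger_endgame hε₀ hB hx hy1 hδ.le hEa' hδ1' hδ2' hn' hmain'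

/-- **No Kolmogorov-class floor for a force with cheap dodgers** (card `truncated-euler-k41-hot`, paper theorem
`FloorWitnessForcesDodgerRoughness`, kill form; conditional on the route support `PacketLemma`, stmt-14032).
If `f` is smooth and admits cheap truncated dodgers, then no constants `ε₀ > 0`, `C`, `Θ`, `ν₀ > 0` give the
band-limited floor datum `KolmogorovFloorDatumAt f ε₀ C Θ ν` at every `ν ∈ (0, ν₀)`. -/
theorem kFloor_false_of_cheapDodgers (hP : PacketLemma) {f : UnitAddTorus (Fin 3) → EuclideanSpace ℝ (Fin 3)}
    (hf : IsSmooth f) (hcheap : CheapDodgers f) {ε₀ C Θ ν₀ : ℝ} (hε₀ : 0 < ε₀) (hν₀ : 0 < ν₀)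
    (hfloor : ∀ ν : ℝ, 0 < ν → ν < ν₀ → KolmogorovFloorDatumAt f ε₀ C Θ ν) : False := by
  obtain ⟨K₁, hK₁⟩ := hP
  -- the certificate at `ν₀/2`: `Θ ≥ 0`, `f ≠ 0`
  have hν2 : 0 < ν₀ / 2 := half_pos hν₀
  have hF : 0 < ∫ x, ‖f x‖ ^ 2 := force_ne_zero_of_floorDatum hf hε₀ hν2 (hfloor _ hν2 (half_lt_self hν₀))
  obtain ⟨N₂, Φ₂, θ₂, hN₂, hband₂, hΘ₂, hθ₂, hu₂⟩ := hfloor _ hν2 (half_lt_self hν₀)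
  have hΘ : 0 ≤ Θ := by linarith
  by_cases hC : C ≤ 0
  · -- `C ≤ 0`: the resolution is `0`, the multiplier vanishes identically, and the floor fails at rest
    have hN0 : N₂ = 0 := by
      have hpow : 0 < (ν₀ / 2) ^ (-(3 / 4 : ℝ)) := Real.rpow_pos_of_pos hν2 _
      have h1 : (N₂ : ℝ) ≤ 0 := le_trans hN₂ (mul_nonpos_of_nonpos_of_nonneg hC hpow.le)
      exact_mod_cast le_antisymm h1 (Nat.cast_nonneg N₂)
    have hW0 : Φ₂.grad 0 = 0 := by
      refine eq_zero_of_forall_mFourierCoeff_eq_zero (isSmooth_grad Φ₂ 0) fun κ => ?_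
      by_cases hκ : κ = 0
      · subst hκ; exact fc_grad_zero Φ₂ 0
      · refine fc_grad_eq_zero Φ₂ hband₂ 0 κ ?_
        rw [hN0]
        have h1 := one_le_freqNormSq_of_ne_zero hκ
        push_cast
        linarith
    have hrest := floorIneqAt_at_rest hν2 (hu₂ 0)
    rw [hW0] at hrest
    simp at hrest
    linarith
  · push Not at hC
    exact kFloor_false_of_cheapDodgers_posC hK₁ hf hcheap hε₀ hν₀ hC hΘ hF hfloor

/-! ## Corollaries: no witness of the pair with this force; the pincer form -/

/-- **No constants make a force with cheap dodgers a witness of the pair**: the `∀ ν`-body of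
`KolmogorovFloorEnsembleCeiling` (floor datum AND ceiling at every `ν < ν₀`) fails for `f` already through its
floor conjunct. -/
theorem not_pairWitness_of_cheapDodgers (hP : PacketLemma) {f : UnitAddTorus (Fin 3) → EuclideanSpace ℝ (Fin 3)}
    (hf : IsSmooth f) (hcheap : CheapDodgers f) :
    ¬ ∃ (ε₀ C Θ E ν₀ : ℝ), 0 < ε₀ ∧ 0 < ν₀ ∧ ∀ ν : ℝ, 0 < ν → ν < ν₀ → KolmogorovFloorDatumAt f ε₀ C Θ ν ∧
      (∀ μ : Measure (Torus.energySpace (Fin 3)), Torus.IsStationaryStatisticalSolution ν f μ →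
        Integrable (fun v : Torus.energySpace (Fin 3) => ‖v‖ ^ 2) μ → Torus.ensembleEnergy μ ≤ E) := by
  rintro ⟨ε₀, C, Θ, E, ν₀, hε₀, hν₀, hall⟩
  exact kFloor_false_of_cheapDodgers hP hf hcheap hε₀ hν₀ fun ν hν hνν₀ => (hall ν hν hνν₀).1

/-- **Cheap dodgers for every admissible force refute the pair** (`KolmogorovFloorEnsembleCeiling`, crux
stmt-14183) — the floor jaw of the pincer closes on every force, given `PacketLemma`. -/
theorem pair_false_of_cheapDodgers (hP : PacketLemma)
    (hall : ∀ f : UnitAddTorus (Fin 3) → EuclideanSpace ℝ (Fin 3), IsSmooth f → IsDivFree f → HasZeroMean f →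
      CheapDodgers f) : ¬ KolmogorovFloorEnsembleCeiling := by
  intro h
  obtain ⟨f, hfs, hfd, hfz, ε₀, C, Θ, ν₀, hε₀, hν₀, hfl⟩ := floorDatum_of_pair h
  exact kFloor_false_of_cheapDodgers hP hfs (hall f hfs hfd hfz) hε₀ hν₀ hfl


/-! ## `PacketLemma` discharged: the kill modulo the dodger hypothesis alone -/

/-- **No Kolmogorov-class floor for a force with cheap dodgers** — unconditional in `PacketLemma`
(`Theorems.packetLemma_proof`, `K₁ = 2²³`). -/
theorem kFloor_false_of_cheapDodgers' {f : UnitAddTorus (Fin 3) → EuclideanSpace ℝ (Fin 3)} (hf : IsSmooth f)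
    (hcheap : CheapDodgers f) {ε₀ C Θ ν₀ : ℝ} (hε₀ : 0 < ε₀) (hν₀ : 0 < ν₀)
    (hfloor : ∀ ν : ℝ, 0 < ν → ν < ν₀ → KolmogorovFloorDatumAt f ε₀ C Θ ν) : False :=
  kFloor_false_of_cheapDodgers Summit.AnomalousDissipation.AnomalousDissipation.Theorems.packetLemma_proof hf hcheap
    hε₀ hν₀ hfloor

/-- **No constants make a force with cheap dodgers a witness of the pair** — unconditional in `PacketLemma`. -/
theorem not_pairWitness_of_cheapDodgers' {f : UnitAddTorus (Fin 3) → EuclideanSpace ℝ (Fin 3)} (hf : IsSmooth f)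
    (hcheap : CheapDodgers f) :
    ¬ ∃ (ε₀ C Θ E ν₀ : ℝ), 0 < ε₀ ∧ 0 < ν₀ ∧ ∀ ν : ℝ, 0 < ν → ν < ν₀ → KolmogorovFloorDatumAt f ε₀ C Θ ν ∧
      (∀ μ : Measure (Torus.energySpace (Fin 3)), Torus.IsStationaryStatisticalSolution ν f μ →
        Integrable (fun v : Torus.energySpace (Fin 3) => ‖v‖ ^ 2) μ → Torus.ensembleEnergy μ ≤ E) :=
  not_pairWitness_of_cheapDodgers Summit.AnomalousDissipation.AnomalousDissipation.Theorems.packetLemma_proof hf hcheap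

/-- **Cheap dodgers for every admissible force refute the pair** `KolmogorovFloorEnsembleCeiling` (crux
stmt-AnomalousDissipation-14183) — unconditional in `PacketLemma`; the one remaining hypothesis is the dodger one. -/
theorem pair_false_of_cheapDodgers'
    (hall : ∀ f : UnitAddTorus (Fin 3) → EuclideanSpace ℝ (Fin 3), IsSmooth f → IsDivFree f → HasZeroMean f →
      CheapDodgers f) : ¬ KolmogorovFloorEnsembleCeiling :=
  pair_false_of_cheapDodgers Summit.AnomalousDissipation.AnomalousDissipation.Theorems.packetLemma_proof hall

end Summit.AnomalousDissipation.AnomalousDissipation.Theorems.KolmogorovFloorEnsembleCeiling.Negative
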